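import Summits.NavierStokesRegularity.NavierStokesRegularity.Theses.ScaledTopAlignment
import Summits.NavierStokesRegularity.NavierStokesRegularity.Theorems.ContinuousAlignmentAprioriContinuousAlignmentStubRegularAligned
import Summits.NavierStokesRegularity.NavierStokesRegularity.Theorems.ScaledTopAlignmentMostTimesHardCoreMeet
import HarnessLib

/-!
# Route `ScaledTopAlignment`, crux `AprioriMostTimesBulkAlignment` (stmt-NavierStokesRegularity-19551), line `birth`,
# stub `stub_coherence_to_mostTimes`: the CLASS-#2 rung «relative-level window coherence ⇒ most-times window bulk
# alignment», with the regular case and the hard-core location of the class-#2 hypothesis H₂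

The birth skeleton `Cruxes/AprioriMostTimesBulkAlignment/Lines/birth.lean` (registered 2026-08-26 by the §C seat
ns-sta-19551-p3; cut verbatim from the planner of record's typed rung, cell ns-regularity-ideate p3 g4
`rung2/RelLevelWindowCoherence.lean`) cuts the deciding crux W3ᵐᵗ of the route one level down along T2/J's separating
class #2 (T2 print map 82e220a54b665863 row 9, J addendum 1): a modulus of continuity `η` of the vorticity direction
`ξ = ω/|ω|` demanded ONLY between a rate-near-max point `x` (`M ≤ |ω(t,x)|`, `κ/(T − t) ≤ |ω(t,x)|`) and the points `y`
of the `λ₀`-RELATIVE top set `{λ₀|ω(t,x)| ≤ |ω(t,y)|}` inside the parabolic window `|x − y| ≤ R₀ √(ν/|ω(t,x)|)` —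
hypothesis H₂ («relative-level window coherence»). This file proves, sorry-free:

* `mostTimesBulkAlignedAt_of_relLevelWindowCoherenceAt` — THE RUNG over an abstract vorticity family `ω`: H₂-at ⇒ the
  most-times window-bulk conclusion of W3ᵐᵗ-at (`λ₀' = max λ₀ ½`, H₂'s `R₀`, `θ = ½`, `E = ∅`; threshold
  `M = M_H(κ) + 4νR₀²/r₀²` with `η < ε` on `(0, r₀)`: then the window radius is `< r₀`, the sign-blind sine is below the
  signed chord `≤ η(‖x − y‖) < ε`, and the `ε`-misaligned part of the relative top set in the window is EMPTY);
* **`stub_coherence_to_mostTimes`** — the REGISTERED stub of the birth line, by name and signature (the rung at the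
  vorticity `curl (u t)` of one velocity field);
* `relLevelWindowCoherenceAt_of_hasSmoothExtensionPast` — the REGULAR CASE of H₂: a classical Leray–Hopf solution from a
  rapidly decaying datum that extends classically past `T` satisfies H₂ at `u` (`λ₀ = ½`, `R₀ = 1`, `η = id`,
  `M = 2L` with the slab Lipschitz constant `L` of the vorticity, `exists_lipschitz_curl_of_hasSmoothExtensionPast`:
  chord `≤ 2‖ω(x) − ω(y)‖/|ω(x)| ≤ 2L‖x − y‖/M = ‖x − y‖`) — so H₂ is ON-PATH (implied by regularity);
* `hasSmoothExtensionPast_of_relLevelWindowCoherenceAt_of_typeI` — the KILL under Type I: H₂ at a solution with the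
  Type-I rate at `T` forces classical extension past `T` (rung + ns-sta-19551-p1's
  `hasSmoothExtensionPast_of_mostTimesBulkAlignedAt_of_typeI`, i.e. p5's zoom kit);
* `relLevelWindowCoherence_doorCalculus` — the hard-core LOCATION of the physics stub by p1's door calculus `door_iff_target_of_kill_of_regular`: the Type-I case of
  H₂ is EQUIVALENT to `ThreadingFlux.Target` (stmt-1217, no Type-I first blow-up) unconditionally, and given the route's
  residual `NoTypeII` the a-priori H₂ is equivalent to Target as well. So class #2 changes the door's LANGUAGE (print
  separation), not its distance from the hard core (census CENSUS-19551.md 699b0fb814a51823).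

Implications between OPEN statements and a provable rung; nothing here proves H₂ a priori or W3ᵐᵗ.
WHAT THIS IS NOT: not NS regularity. hard core evaded: NO.

## References

* Y. Giga, H. Miura, Comm. Math. Phys. 303 (2011) 289–300 = HUPS #956: Thm 1.1, condition (CA) (§1). [GigaMiura2011]
* P. Constantin, C. Fefferman, Indiana Univ. Math. J. 42 (1993) 775–789, §1. [ConstantinFefferman1993]
-/

noncomputable section

-- the summit and its single sub-problem share the name (CONVENTIONS §1), as in every Theorems file
set_option linter.dupNamespace false

open MeasureTheory Set Function Filter Topology
open scoped RealInnerProductSpace ENNReal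

namespace Summit.NavierStokesRegularity.NavierStokesRegularity.Theorems

open Literature.Analysis Literature.Analysis.FluidPDE

/-! ### The rung over an abstract vorticity family -/

/-- **Class-#2 rung (abstract vorticity family): relative-level window coherence ⇒ most-times window bulk alignment.**
Let `ω : ℝ → ℝ³ → ℝ³`, `ν > 0`. Suppose H₂ at `ω`: there are `λ₀ < 1`, `R₀ > 0`, `η → 0` at `0⁺` and for every `κ > 0`
an `M > 0` such that for `t ∈ [0,T)`, `x` with `M ≤ |ω(t,x)|`, `κ/(T − t) ≤ |ω(t,x)|` and `y ≠ x` with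
`λ₀|ω(t,x)| ≤ |ω(t,y)|`, `|x − y| ≤ R₀√(ν/|ω(t,x)|)` the signed chord of the directions is `≤ η(‖x − y‖)`. Then the
most-times window-bulk conclusion holds at `ω` with `λ₀' = max λ₀ ½`, `R₀`, `θ = ½` and `E = ∅`: given `κ, ε, δ`, above
the threshold `M_H(κ) + 4νR₀²/r₀²` (`η < ε` on `(0, r₀)`) the `ε`-misaligned part of the relative top set inside the
window is empty (sine `≤` chord for unit vectors, `sqrt_one_sub_inner_sq_le_norm_sub`). [folklore] -/
theorem mostTimesBulkAlignedAt_of_relLevelWindowCoherenceAt {ν T : ℝ} (hν : 0 < ν)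
    {ω : ℝ → EuclideanSpace ℝ (Fin 3) → EuclideanSpace ℝ (Fin 3)}
    (hH : ∃ lam0 : ℝ, lam0 < 1 ∧ ∃ R0 : ℝ, 0 < R0 ∧ ∃ η : ℝ → ℝ, Tendsto η (𝓝[>] 0) (𝓝 0) ∧
      ∀ κ : ℝ, 0 < κ → ∃ M : ℝ, 0 < M ∧ ∀ t ∈ Set.Ico 0 T, ∀ x y : EuclideanSpace ℝ (Fin 3),
        M ≤ ‖ω t x‖ → κ / (T - t) ≤ ‖ω t x‖ → lam0 * ‖ω t x‖ ≤ ‖ω t y‖ →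
        ‖x - y‖ ≤ R0 * Real.sqrt (ν / ‖ω t x‖) → x ≠ y →
        ‖(‖ω t x‖⁻¹ • ω t x) - (‖ω t y‖⁻¹ • ω t y)‖ ≤ η ‖x - y‖) :
    ∃ lam0 : ℝ, lam0 < 1 ∧ ∃ R0 : ℝ, 0 < R0 ∧ ∃ θ : ℝ, θ < 1 ∧ ∀ κ : ℝ, 0 < κ → ∀ ε : ℝ, 0 < ε →
      ∀ δ : ℝ, 0 < δ → ∃ M : ℝ, 0 < M ∧ ∃ E : Set ℝ,
        (∃ h0 : ℝ, 0 < h0 ∧ ∀ h : ℝ, 0 < h → h < h0 →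
          volume (E ∩ Set.Ioo (T - h) T) ≤ ENNReal.ofReal (θ * h)) ∧
        ∀ t ∈ Set.Ico 0 T, t ∉ E → ∀ x : EuclideanSpace ℝ (Fin 3), M ≤ ‖ω t x‖ → κ / (T - t) ≤ ‖ω t x‖ →
          volume {y : EuclideanSpace ℝ (Fin 3) | lam0 * ‖ω t x‖ ≤ ‖ω t y‖ ∧
              ‖x - y‖ ≤ R0 * Real.sqrt (ν / ‖ω t x‖) ∧
              ε < Real.sqrt (1 - (inner ℝ (‖ω t x‖⁻¹ • ω t x) (‖ω t y‖⁻¹ • ω t y)) ^ 2)}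
            ≤ ENNReal.ofReal (δ * Real.sqrt (ν / ‖ω t x‖) ^ 3) := by
  obtain ⟨lam0, hlam0, R0, hR0, η, hη, hmod⟩ := hH
  refine ⟨max lam0 (1 / 2), max_lt hlam0 (by norm_num), R0, hR0, 1 / 2, by norm_num, ?_⟩
  intro κ hκ ε hε δ _hδ
  obtain ⟨M₁, hM₁, hM₁'⟩ := hmod κ hκ
  -- the modulus is below `ε` on a right-neighbourhood `(0, r₀)`
  obtain ⟨r₀, hr₀, hηε⟩ : ∃ r₀ > 0, ∀ s : ℝ, 0 < s → s < r₀ → η s < ε := by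
    obtain ⟨r₀, hr₀, h⟩ := Metric.tendsto_nhdsWithin_nhds.mp hη ε hε
    refine ⟨r₀, hr₀, fun s hs hsr => ?_⟩
    have h1 := h (show s ∈ Ioi (0:ℝ) from hs)
      (by rw [dist_zero_right, Real.norm_eq_abs, abs_of_pos hs]; exact hsr)
    rw [dist_zero_right, Real.norm_eq_abs] at h1
    exact lt_of_abs_lt h1
  have hA : 0 < 4 * ν * R0 ^ 2 / r₀ ^ 2 := by positivity
  refine ⟨M₁ + 4 * ν * R0 ^ 2 / r₀ ^ 2, by positivity, ∅, ⟨1, one_pos, fun h _ _ => by simp⟩, ?_⟩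
  intro t ht _ x hMx hrate
  have ha0 : 0 < ‖ω t x‖ := lt_of_lt_of_le (by positivity) hMx
  have hM₁x : M₁ ≤ ‖ω t x‖ := by linarith
  have hMa : 4 * ν * R0 ^ 2 / r₀ ^ 2 ≤ ‖ω t x‖ := by linarith
  have hxa : ω t x ≠ 0 := norm_pos_iff.1 ha0
  have hua : ‖(‖ω t x‖⁻¹ • ω t x)‖ = 1 := norm_smul_inv_norm hxa
  -- the window radius is below `r₀`
  have hwin : R0 * Real.sqrt (ν / ‖ω t x‖) < r₀ := by
    have hq : ν / ‖ω t x‖ ≤ (r₀ / (2 * R0)) ^ 2 := by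
      rw [div_le_iff₀ ha0]
      have h1 : 4 * ν * R0 ^ 2 ≤ ‖ω t x‖ * r₀ ^ 2 := by
        have := (div_le_iff₀ (by positivity : (0:ℝ) < r₀ ^ 2)).1 hMa
        linarith
      have e : (r₀ / (2 * R0)) ^ 2 * ‖ω t x‖ = ‖ω t x‖ * r₀ ^ 2 / (4 * R0 ^ 2) := by
        field_simp
        ring
      rw [e, le_div_iff₀ (by positivity)]
      nlinarith
    have hs : Real.sqrt (ν / ‖ω t x‖) ≤ r₀ / (2 * R0) := by
      calc Real.sqrt (ν / ‖ω t x‖) ≤ Real.sqrt ((r₀ / (2 * R0)) ^ 2) := Real.sqrt_le_sqrt hq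
        _ = r₀ / (2 * R0) := Real.sqrt_sq (by positivity)
    have h2 : R0 * Real.sqrt (ν / ‖ω t x‖) ≤ r₀ / 2 := by
      calc R0 * Real.sqrt (ν / ‖ω t x‖) ≤ R0 * (r₀ / (2 * R0)) := mul_le_mul_of_nonneg_left hs hR0.le
        _ = r₀ / 2 := by field_simp
    linarith
  -- the misaligned part of the relative top set in the window is empty
  have hempty : {y : EuclideanSpace ℝ (Fin 3) | max lam0 (1 / 2) * ‖ω t x‖ ≤ ‖ω t y‖ ∧
      ‖x - y‖ ≤ R0 * Real.sqrt (ν / ‖ω t x‖) ∧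
      ε < Real.sqrt (1 - (inner ℝ (‖ω t x‖⁻¹ • ω t x) (‖ω t y‖⁻¹ • ω t y)) ^ 2)} = ∅ := by
    refine Set.eq_empty_iff_forall_notMem.2 fun y hy => ?_
    obtain ⟨h1, h2, h3⟩ := hy
    -- `y` is at H₂'s relative level and carries non-zero vorticity
    have hrel : lam0 * ‖ω t x‖ ≤ ‖ω t y‖ :=
      le_trans (mul_le_mul_of_nonneg_right (le_max_left _ _) ha0.le) h1
    have hhalf : (1 / 2 : ℝ) * ‖ω t x‖ ≤ max lam0 (1 / 2) * ‖ω t x‖ :=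
      mul_le_mul_of_nonneg_right (le_max_right _ _) ha0.le
    have hyb0 : 0 < ‖ω t y‖ := by linarith
    have hyb : ω t y ≠ 0 := norm_pos_iff.1 hyb0
    have hub : ‖(‖ω t y‖⁻¹ • ω t y)‖ = 1 := norm_smul_inv_norm hyb
    by_cases hxy : x = y
    · -- same point: the sine vanishes, contradicting `ε < sine`
      subst hxy
      have hself : inner ℝ (‖ω t x‖⁻¹ • ω t x) (‖ω t x‖⁻¹ • ω t x) = 1 := by
        rw [real_inner_self_eq_norm_sq, hua]; norm_num
      rw [hself] at h3
      norm_num at h3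
      linarith
    · have hpos : 0 < ‖x - y‖ := norm_pos_iff.mpr (sub_ne_zero.mpr hxy)
      have hrad : ‖x - y‖ < r₀ := lt_of_le_of_lt h2 hwin
      have hchord := hM₁' t ht x y hM₁x hrate hrel h2 hxy
      have hlt : Real.sqrt (1 - (inner ℝ (‖ω t x‖⁻¹ • ω t x) (‖ω t y‖⁻¹ • ω t y)) ^ 2) < ε :=
        calc Real.sqrt (1 - (inner ℝ (‖ω t x‖⁻¹ • ω t x) (‖ω t y‖⁻¹ • ω t y)) ^ 2)
            ≤ ‖(‖ω t x‖⁻¹ • ω t x) - (‖ω t y‖⁻¹ • ω t y)‖ :=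
              sqrt_one_sub_inner_sq_le_norm_sub _ _ hua hub
          _ ≤ η ‖x - y‖ := hchord
          _ < ε := hηε _ hpos hrad
      linarith
  rw [hempty, measure_empty]
  simp

/-! ### The registered stub -/

/-- **Stub `stub_coherence_to_mostTimes` of the birth line of crux `AprioriMostTimesBulkAlignment`
(stmt-NavierStokesRegularity-19551), registered signature (= cell `NsregP3.R9.RungClass2` verbatim).** At ONE velocity
field `u` on `[0, T)` (`ν, T > 0`): relative-level window coherence H₂ of the vorticity direction at `u` implies the
most-times window-bulk conclusion of W3ᵐᵗ at `u` — the rung `mostTimesBulkAlignedAt_of_relLevelWindowCoherenceAt` at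
the vorticity family `ω t = curl (u t)`. The hypothesis `0 < T` is carried but not used. [folklore] -/
theorem stub_coherence_to_mostTimes :
    ∀ (ν T : ℝ), 0 < ν → 0 < T →
      ∀ (u : ℝ → EuclideanSpace ℝ (Fin 3) → EuclideanSpace ℝ (Fin 3)),
        (∃ lam0 : ℝ, lam0 < 1 ∧ ∃ R0 : ℝ, 0 < R0 ∧ ∃ η : ℝ → ℝ, Filter.Tendsto η (𝓝[>] 0) (𝓝 0) ∧
          ∀ κ : ℝ, 0 < κ → ∃ M : ℝ, 0 < M ∧ ∀ t ∈ Set.Ico 0 T, ∀ x y : EuclideanSpace ℝ (Fin 3),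
            M ≤ ‖Literature.Analysis.FluidPDE.curl (u t) x‖ →
            κ / (T - t) ≤ ‖Literature.Analysis.FluidPDE.curl (u t) x‖ →
            lam0 * ‖Literature.Analysis.FluidPDE.curl (u t) x‖ ≤ ‖Literature.Analysis.FluidPDE.curl (u t) y‖ →
            ‖x - y‖ ≤ R0 * Real.sqrt (ν / ‖Literature.Analysis.FluidPDE.curl (u t) x‖) → x ≠ y →
            ‖(‖Literature.Analysis.FluidPDE.curl (u t) x‖⁻¹ • Literature.Analysis.FluidPDE.curl (u t) x) -
                (‖Literature.Analysis.FluidPDE.curl (u t) y‖⁻¹ • Literature.Analysis.FluidPDE.curl (u t) y)‖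
              ≤ η ‖x - y‖) →
        ∃ lam0 : ℝ, lam0 < 1 ∧ ∃ R0 : ℝ, 0 < R0 ∧ ∃ θ : ℝ, θ < 1 ∧ ∀ κ : ℝ, 0 < κ → ∀ ε : ℝ, 0 < ε →
          ∀ δ : ℝ, 0 < δ → ∃ M : ℝ, 0 < M ∧ ∃ E : Set ℝ,
            (∃ h0 : ℝ, 0 < h0 ∧ ∀ h : ℝ, 0 < h → h < h0 →
              MeasureTheory.volume (E ∩ Set.Ioo (T - h) T) ≤ ENNReal.ofReal (θ * h)) ∧
            ∀ t ∈ Set.Ico 0 T, t ∉ E → ∀ x : EuclideanSpace ℝ (Fin 3),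
              M ≤ ‖Literature.Analysis.FluidPDE.curl (u t) x‖ →
              κ / (T - t) ≤ ‖Literature.Analysis.FluidPDE.curl (u t) x‖ →
              MeasureTheory.volume {y : EuclideanSpace ℝ (Fin 3) |
                  lam0 * ‖Literature.Analysis.FluidPDE.curl (u t) x‖ ≤ ‖Literature.Analysis.FluidPDE.curl (u t) y‖ ∧
                  ‖x - y‖ ≤ R0 * Real.sqrt (ν / ‖Literature.Analysis.FluidPDE.curl (u t) x‖) ∧
                  ε < Real.sqrt (1 - (inner ℝ
                    (‖Literature.Analysis.FluidPDE.curl (u t) x‖⁻¹ • Literature.Analysis.FluidPDE.curl (u t) x)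
                    (‖Literature.Analysis.FluidPDE.curl (u t) y‖⁻¹ • Literature.Analysis.FluidPDE.curl (u t) y)) ^ 2)}
                ≤ ENNReal.ofReal (δ * Real.sqrt (ν / ‖Literature.Analysis.FluidPDE.curl (u t) x‖) ^ 3) := by
  intro ν T hν _hT u hH
  exact mostTimesBulkAlignedAt_of_relLevelWindowCoherenceAt (ω := fun t => curl (u t)) hν hH

/-! ### The regular case of H₂ -/

/-- **Regular case of H₂ at one solution.** A classical solution of the unforced Navier–Stokes system on
`ℝ³ × [0, T)` (`ν, T > 0`), Leray–Hopf from its rapidly decaying datum, that extends classically past `T` has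
relative-level window coherence at `u`, with `λ₀ = ½`, `R₀ = 1`, the linear modulus `η = id` and, for every `κ`,
the threshold `M = 2L`, where `L` is the uniform spatial Lipschitz constant of the vorticity on the slab
(`exists_lipschitz_curl_of_hasSmoothExtensionPast`): chord `≤ 2‖ω(x) − ω(y)‖/|ω(x)|`
(`norm_normalize_sub_normalize_le`) `≤ 2L‖x − y‖/(2L) = ‖x − y‖`. The classical-solution hypothesis on `[0,T)` is
carried for the door's signature but not used (the extension supplies it). So H₂ is implied by regularity (on-path).
[folklore] -/
theorem relLevelWindowCoherenceAt_of_hasSmoothExtensionPast {ν T : ℝ} (hν : 0 < ν) (hT : 0 < T)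
    {u : ℝ → EuclideanSpace ℝ (Fin 3) → EuclideanSpace ℝ (Fin 3)}
    (hLH : IsLerayHopfOn T ν 0 (u 0) u) (hdec : HasRapidSpatialDecay (u 0))
    (hext : HasSmoothExtensionPast ν 0 u T) :
    ∃ lam0 : ℝ, lam0 < 1 ∧ ∃ R0 : ℝ, 0 < R0 ∧ ∃ η : ℝ → ℝ, Tendsto η (𝓝[>] 0) (𝓝 0) ∧
      ∀ κ : ℝ, 0 < κ → ∃ M : ℝ, 0 < M ∧ ∀ t ∈ Set.Ico 0 T, ∀ x y : EuclideanSpace ℝ (Fin 3),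
        M ≤ ‖curl (u t) x‖ → κ / (T - t) ≤ ‖curl (u t) x‖ → lam0 * ‖curl (u t) x‖ ≤ ‖curl (u t) y‖ →
        ‖x - y‖ ≤ R0 * Real.sqrt (ν / ‖curl (u t) x‖) → x ≠ y →
        ‖(‖curl (u t) x‖⁻¹ • curl (u t) x) - (‖curl (u t) y‖⁻¹ • curl (u t) y)‖ ≤ η ‖x - y‖ := by
  obtain ⟨L, hL, hlip⟩ := exists_lipschitz_curl_of_hasSmoothExtensionPast hν hT hLH hdec hext
  have hid : Tendsto (fun s : ℝ => s) (𝓝[>] (0:ℝ)) (𝓝 0) :=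
    tendsto_nhdsWithin_of_tendsto_nhds (Filter.tendsto_id)
  refine ⟨1 / 2, by norm_num, 1, one_pos, fun s => s, hid, fun κ _hκ => ⟨2 * L, by positivity, ?_⟩⟩
  intro t ht x y hMx _hrate _hrel _hwin _hxy
  have ha0 : 0 < ‖curl (u t) x‖ := lt_of_lt_of_le (by positivity) hMx
  have hxa : curl (u t) x ≠ 0 := norm_pos_iff.1 ha0
  have h1 := norm_normalize_sub_normalize_le (curl (u t) x) (curl (u t) y) hxa
  have h2 : ‖curl (u t) x - curl (u t) y‖ ≤ L * ‖x - y‖ := hlip t ht x y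
  have h3 : 2 * ‖curl (u t) x - curl (u t) y‖ / ‖curl (u t) x‖ ≤ ‖x - y‖ := by
    rw [div_le_iff₀ ha0]
    have h4 : 2 * L * ‖x - y‖ ≤ ‖curl (u t) x‖ * ‖x - y‖ :=
      mul_le_mul_of_nonneg_right hMx (norm_nonneg _)
    nlinarith
  exact h1.trans (by simpa [mul_comm] using h3)

/-! ### The kill under Type I -/

/-- **H₂ at a solution excludes a Type-I first blow-up there**: a classical Leray–Hopf solution from a rapidly decaying
datum with relative-level window coherence at `u` and the Type-I rate at `T` extends classically past `T` (the rung,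
then `hasSmoothExtensionPast_of_mostTimesBulkAlignedAt_of_typeI` = p5's zoom kit `false_of_mostTimesWindowBulkAligned_typeI`).
[cite: GigaMiura2011, Thm 1.1 with Rmk 1.4 and §2.1 (HUPS preprint #956 pp. 3–9)] -/
theorem hasSmoothExtensionPast_of_relLevelWindowCoherenceAt_of_typeI {ν T : ℝ} (hν : 0 < ν) (hT : 0 < T)
    {u : ℝ → EuclideanSpace ℝ (Fin 3) → EuclideanSpace ℝ (Fin 3)} {p : ℝ → EuclideanSpace ℝ (Fin 3) → ℝ}
    (hcl : IsClassicalNSSolutionOn (Ico 0 T) ν 0 u p) (hLH : IsLerayHopfOn T ν 0 (u 0) u)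
    (hdec : HasRapidSpatialDecay (u 0))
    (hH : ∃ lam0 : ℝ, lam0 < 1 ∧ ∃ R0 : ℝ, 0 < R0 ∧ ∃ η : ℝ → ℝ, Tendsto η (𝓝[>] 0) (𝓝 0) ∧
      ∀ κ : ℝ, 0 < κ → ∃ M : ℝ, 0 < M ∧ ∀ t ∈ Set.Ico 0 T, ∀ x y : EuclideanSpace ℝ (Fin 3),
        M ≤ ‖curl (u t) x‖ → κ / (T - t) ≤ ‖curl (u t) x‖ → lam0 * ‖curl (u t) x‖ ≤ ‖curl (u t) y‖ →
        ‖x - y‖ ≤ R0 * Real.sqrt (ν / ‖curl (u t) x‖) → x ≠ y →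
        ‖(‖curl (u t) x‖⁻¹ • curl (u t) x) - (‖curl (u t) y‖⁻¹ • curl (u t) y)‖ ≤ η ‖x - y‖)
    (hI : IsTypeIBlowup u T) : HasSmoothExtensionPast ν 0 u T :=
  hasSmoothExtensionPast_of_mostTimesBulkAlignedAt_of_typeI hν hT hcl hLH hdec
    (mostTimesBulkAlignedAt_of_relLevelWindowCoherenceAt (ω := fun t => curl (u t)) hν hH) hI

/-! ### Hard-core location of the class-#2 hypothesis (door calculus) -/

/-- **Door calculus for H₂.** (i) Unconditionally, the Type-I case of the class-#2 door «Type-I rate ⇒ H₂ at `u`» (over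
all classical Leray–Hopf solutions from rapidly decaying data) is EQUIVALENT to `ThreadingFlux.Target`
(stmt-NavierStokesRegularity-1217, no Type-I first blow-up); (ii) given the route's residual `NoTypeII`, the a-priori
H₂ (physics stub of the birth line) is EQUIVALENT to Target. Instance of ns-sta-19551-p1's
`door_iff_target_of_kill_of_regular` with the kill `hasSmoothExtensionPast_of_relLevelWindowCoherenceAt_of_typeI` and
the regular case `relLevelWindowCoherenceAt_of_hasSmoothExtensionPast`. [folklore] -/
theorem relLevelWindowCoherence_doorCalculus :
    ((∀ (ν T : ℝ), 0 < ν → 0 < T → ∀ (u : ℝ → EuclideanSpace ℝ (Fin 3) → EuclideanSpace ℝ (Fin 3))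
        (p : ℝ → EuclideanSpace ℝ (Fin 3) → ℝ), IsClassicalNSSolutionOn (Set.Ico 0 T) ν 0 u p →
        IsLerayHopfOn T ν 0 (u 0) u → HasRapidSpatialDecay (u 0) → IsTypeIBlowup u T →
        ∃ lam0 : ℝ, lam0 < 1 ∧ ∃ R0 : ℝ, 0 < R0 ∧ ∃ η : ℝ → ℝ, Tendsto η (𝓝[>] 0) (𝓝 0) ∧
          ∀ κ : ℝ, 0 < κ → ∃ M : ℝ, 0 < M ∧ ∀ t ∈ Set.Ico 0 T, ∀ x y : EuclideanSpace ℝ (Fin 3),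
            M ≤ ‖curl (u t) x‖ → κ / (T - t) ≤ ‖curl (u t) x‖ → lam0 * ‖curl (u t) x‖ ≤ ‖curl (u t) y‖ →
            ‖x - y‖ ≤ R0 * Real.sqrt (ν / ‖curl (u t) x‖) → x ≠ y →
            ‖(‖curl (u t) x‖⁻¹ • curl (u t) x) - (‖curl (u t) y‖⁻¹ • curl (u t) y)‖ ≤ η ‖x - y‖) ↔
      Summit.NavierStokesRegularity.NavierStokesRegularity.Theses.ThreadingFlux.Target) ∧
    (Summit.NavierStokesRegularity.NavierStokesRegularity.Theses.ScaledTopAlignment.NoTypeII →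
      ((∀ (ν T : ℝ), 0 < ν → 0 < T → ∀ (u : ℝ → EuclideanSpace ℝ (Fin 3) → EuclideanSpace ℝ (Fin 3))
          (p : ℝ → EuclideanSpace ℝ (Fin 3) → ℝ), IsClassicalNSSolutionOn (Set.Ico 0 T) ν 0 u p →
          IsLerayHopfOn T ν 0 (u 0) u → HasRapidSpatialDecay (u 0) →
          ∃ lam0 : ℝ, lam0 < 1 ∧ ∃ R0 : ℝ, 0 < R0 ∧ ∃ η : ℝ → ℝ, Tendsto η (𝓝[>] 0) (𝓝 0) ∧
            ∀ κ : ℝ, 0 < κ → ∃ M : ℝ, 0 < M ∧ ∀ t ∈ Set.Ico 0 T, ∀ x y : EuclideanSpace ℝ (Fin 3),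
              M ≤ ‖curl (u t) x‖ → κ / (T - t) ≤ ‖curl (u t) x‖ → lam0 * ‖curl (u t) x‖ ≤ ‖curl (u t) y‖ →
              ‖x - y‖ ≤ R0 * Real.sqrt (ν / ‖curl (u t) x‖) → x ≠ y →
              ‖(‖curl (u t) x‖⁻¹ • curl (u t) x) - (‖curl (u t) y‖⁻¹ • curl (u t) y)‖ ≤ η ‖x - y‖) ↔
        Summit.NavierStokesRegularity.NavierStokesRegularity.Theses.ThreadingFlux.Target)) :=
  door_iff_target_of_kill_of_regular
    (D := fun ν T u _p => ∃ lam0 : ℝ, lam0 < 1 ∧ ∃ R0 : ℝ, 0 < R0 ∧ ∃ η : ℝ → ℝ,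
      Tendsto η (𝓝[>] 0) (𝓝 0) ∧
      ∀ κ : ℝ, 0 < κ → ∃ M : ℝ, 0 < M ∧ ∀ t ∈ Set.Ico 0 T, ∀ x y : EuclideanSpace ℝ (Fin 3),
        M ≤ ‖curl (u t) x‖ → κ / (T - t) ≤ ‖curl (u t) x‖ → lam0 * ‖curl (u t) x‖ ≤ ‖curl (u t) y‖ →
        ‖x - y‖ ≤ R0 * Real.sqrt (ν / ‖curl (u t) x‖) → x ≠ y →
        ‖(‖curl (u t) x‖⁻¹ • curl (u t) x) - (‖curl (u t) y‖⁻¹ • curl (u t) y)‖ ≤ η ‖x - y‖)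
    (fun _ _ hν hT _ _ hcl hLH hdec hH hI =>
      hasSmoothExtensionPast_of_relLevelWindowCoherenceAt_of_typeI hν hT hcl hLH hdec hH hI)
    (fun _ _ hν hT _ _ _ hLH hdec hext =>
      relLevelWindowCoherenceAt_of_hasSmoothExtensionPast hν hT hLH hdec hext)

end Summit.NavierStokesRegularity.NavierStokesRegularity.Theorems

end
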